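import Mathlib.Analysis.SpecialFunctions.Pow.Real
import Literature.Computability.Complexity.BoolEncodings
import Literature.Computability.Complexity.Promise
import HarnessLib

/-!
# Complexity core: gap constraint satisfaction problems (MaxCSP) and the sliding-scale PCP

Trunk `CplxCore`; support for the NP-hardness of the partial-function Minimum Circuit Size
Problem `MCSP*` (`Literature.Computability.Complexity.isRandNPHard_MCSPStar`; Hirahara, FOCS 2022, Thm. 1.2 = Thm. 8.5 of
ECCC TR22-119) through Hirahara's Thm. 5.2 (NP-hardness of the gap problem `gapCMMSA`,
`MetaComplexity/CMMSA.lean`), whose proof is the Dinur–Safra reduction applied to a *gap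
constraint satisfaction problem* produced by a sliding-scale PCP (Hirahara 2022, Lemma 5.3 =
Dinur–Fischer–Kindler–Raz–Safra 2011 / Dinur–Harsha–Kindler 2015, restated "in terms of
MaxCSP" on p. 16). This file vendors

* `CSPConstraint` / `CSPInstance` — instances `Ψ = {C₁, …, C_m}` of MaxCSP over `n` variables
  with values in an alphabet `Σ = [q]`: a constraint is the list `vars` of the variables it
  depends on together with the list `accepting` of its accepting local assignments
  (`C⁻¹(1)`, values listed in the order of `vars`); `IsSatisfiedBy`, `satCount`
  (`#{j | Cⱼ(a) = 1}`), `numConstraints`, `WellFormed`, `HasArity D` ("each constraint depends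
  on exactly `D` variables"), and the Boolean `encoding`;
* `gapCSP D Q δ : PromiseProblem` — the gap problem of distinguishing satisfiable instances
  from instances in which every assignment satisfies fewer than a `δ(n)`-fraction of the
  constraints, on well-formed instances of arity exactly `D`, alphabet size `≤ Q(n)` and
  `m ≥ 1` constraints (`n = numVars`); disjoint whenever `δ ≤ 1` (`gapCSP_disjoint`), in
  particular at all the parameters of Lemma 5.3 (`gapCSP_logPow_disjoint`);
* no named fact: Lemma 5.3 itself (NP-hardness of the gap CSP at soundness
  `δ(n) = (log n)^{-γ}`, alphabet `(log n)^{c γ}`, arity an absolute constant `D`) is vendored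
  in the companion file `GapCSPQueried.lean` as `Hirahara2022_lem53_logPow_queried`, in the
  compact form — every variable queried — that the Dinur–Safra reduction of the proof of
  Thm. 5.2 consumes; its corollary for `gapCSP` is `isNPHard_gapCSP_logPow_of_queried` there
  (an earlier revision of this file carried that corollary as a second named fact,
  `Hirahara2022_lem53_logPow`, with no consumer; it was merged into the compact form);
* API: `satCount_le_numConstraints`, `satCount_eq_numConstraints_iff`, `GapCSP.noSet_mono`,
  `GapCSP.disjoint_yesSet_noSet`, `gapCSP_disjoint`, `rpow_neg_natLog_le_one`,
  `gapCSP_logPow_disjoint`, `IsHard.gapCSP_mono`.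

## Design choices

* Variables and values are natural numbers; assignments are total maps `a : ℕ → ℕ`. A
  constraint is satisfied by `a` iff the local view `vars.map a` is one of its accepting local
  assignments, so values `≥ q` never help and the No condition may quantify over all
  `a : ℕ → ℕ`. `WellFormed` asks: variables `< n` and pairwise distinct inside a constraint
  (a PCP verifier's queries are distinct positions), accepting views of the right length with
  values `< q`, listed without repetition, and `m ≥ 1` (a verifier has at least one coin
  outcome).
* Probabilities are cleared of denominators: Yes asks that some assignment satisfies every
  constraint, No that `satCount a < δ(n) · m` for all `a` — the *strict* form, as
  `CMMSA.noSet` (Hirahara, proof of Thm. 5.2, writes "any assignment to `Ψ` can satisfy at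
  most a `δ`-fraction of constraints"; at the level of the free constants of Lemma 5.3 the two
  forms are interchangeable, a PCP with soundness error `δ/2` having error `< δ`). The strict
  form makes the promise problem disjoint for every `δ ≤ 1` with no proviso on the size: a
  satisfiable instance has `satCount = m`, never `< δ m`. This matters for the NP-hardness
  statement of Lemma 5.3 (`Hirahara2022_lem53_logPow_queried`, `GapCSPQueried.lean`): with
  `≤` the degenerate sizes `n ∈ {2, 3}` (where `(log₂ n)^{-γ} = 1`) would put the satisfiable
  one-constraint instance in both parts and make "NP-hard" provable by a constant reduction
  (review of the first version of this file); with `<` and `δ(n) = (log₂ n)^{-γ} ≤ 1` for all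
  `n` (`rpow_neg_natLog_le_one`: `0^{-γ} = 0`, `1^{-γ} = 1`, and `< 1` from `n ≥ 4` on) no
  instance is in both parts (`gapCSP_logPow_disjoint`).
* The parameter functions are evaluated at the number `n = numVars` of CSP variables (for a
  PCP with `O(log n)` coins and `O(1)` queries the proof length is polynomial in the input
  length, so polylogarithmic parameters change by constant factors only, absorbed in the
  free constants `c, γ` of Lemma 5.3 as vendored).
* Lemma 5.3 is printed for every `β > 0` and every soundness function `δ` with
  `δ(n) ≥ 2^{-(log n)^{1-β}}` (an `O(1/β)`-query PCP over an alphabet of size `poly(1/δ)` with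
  `O(log n)` coins and perfect completeness); its use in Thm. 5.2 at `Δ(n) = (log n)^{1/2}`
  takes `δ = Δ^{-Ω(1/D)}`, a negative power of `log n`. As for `Hirahara2022_thm52_sqrtLog`
  (`CMMSA.lean`), the printed quantification over arbitrary `δ` hides a constructibility
  hypothesis (the verifier computes its alphabet from `δ(n)`), so we vendor the family the
  proof uses: `δ(n) = (log n)^{-γ}`, `γ > 0` real (for irrational `γ` sandwich between rational
  exponents; the constants `c` and the free `γ` absorb it), which satisfies the range condition
  for every `β < 1`; the query bound is then an absolute constant `D` and the alphabet bound
  `poly(1/δ) = (log n)^{c γ}`.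
* Mathlib has no constraint satisfaction or PCP material (searched `CSP`, `MaxCSP`,
  `LabelCover`, `Constraint`); in the tree, `gapE3SAT` (`Approximation.lean`, Håstad) is the
  Boolean E3-CNF gap problem and `PCPVerifier` (`PCP.lean`) the Boolean-proof verifier —
  Lemma 5.3 needs the large-alphabet, exact-arity MaxCSP form, which is new here;
  `PromiseProblem`, `PromiseProblem.IsNPHard` and the `Encoding` combinators are the tree's
  (`Promise.lean`, `BoolEncodings.lean`).

## References

* S. Hirahara, *NP-hardness of learning programs and partial MCSP*, FOCS 2022; ECCC TR22-119
  (numbering used here): Lemma 5.3 and the proof of Thm. 5.2 (pp. 16–18).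
* I. Dinur, E. Fischer, G. Kindler, R. Raz, S. Safra, *PCP characterizations of NP: toward a
  polynomially-small error-probability*, Comput. Complexity 20 (2011), Thm. 1.
* I. Dinur, P. Harsha, G. Kindler, *Polynomially low error PCPs with polyloglog n queries via
  modular composition*, STOC 2015, Thm. 1.1–1.2.
* S. Arora, B. Barak, *Computational Complexity: A Modern Approach*, CUP 2009, Def. 11.11
  (`qCSP`), §11.3 (gap CSPs and PCPs), Def. 22.3 (CSPs over large alphabets).
-/

namespace Literature.Computability.Complexity

open _root_.Computability

/-! ### Constraint satisfaction instances -/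

/-- A constraint of a MaxCSP instance: the list `vars` of the variables it depends on
(`dom`, in query order) and the list `accepting` of its accepting local assignments, each a
list of values for `vars` in the same order (`C⁻¹(1)` in the proof of Thm. 5.2).
[cite: Hirahara2022PartialMCSP, proof of Thm. 5.2 (p. 16)] -/
structure CSPConstraint where
  /-- The variables the constraint depends on, in order. -/
  vars : List ℕ
  /-- The accepting local assignments: value lists for `vars`. -/
  accepting : List (List ℕ)

namespace CSPConstraint

/-- `C` is satisfied by the assignment `a : ℕ → ℕ` iff the local view `vars.map a` is an
accepting local assignment. [cite: Hirahara2022PartialMCSP, proof of Thm. 5.2 (p. 16)] -/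
def IsSatisfiedBy (C : CSPConstraint) (a : ℕ → ℕ) : Bool :=
  decide (C.vars.map a ∈ C.accepting)

/-- Unfolding of `IsSatisfiedBy`. [cite: Hirahara2022PartialMCSP, proof of Thm. 5.2 (p. 16)] -/
theorem isSatisfiedBy_eq_true_iff (C : CSPConstraint) (a : ℕ → ℕ) :
    C.IsSatisfiedBy a = true ↔ C.vars.map a ∈ C.accepting := by
  simp [IsSatisfiedBy]

/-- Well-formed constraints over `n` variables and the alphabet `[q]`: variables `< n` and
pairwise distinct, accepting views of length `|vars|` with values `< q`, without repetition.
[cite: Hirahara2022PartialMCSP, proof of Thm. 5.2 (p. 16)] -/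
def WellFormed (n q : ℕ) (C : CSPConstraint) : Prop :=
  (∀ x ∈ C.vars, x < n) ∧ C.vars.Nodup ∧ C.accepting.Nodup ∧
    ∀ r ∈ C.accepting, r.length = C.vars.length ∧ ∀ v ∈ r, v < q

/-- Well-formedness of a constraint is decidable. [folklore] -/
instance decidableWellFormed (n q : ℕ) (C : CSPConstraint) : Decidable (C.WellFormed n q) := by
  unfold WellFormed
  infer_instance

end CSPConstraint

/-- An instance `Ψ = {C₁, …, C_m}` of MaxCSP: the number `numVars = n` of variables, the
alphabet size `alphabetSize = |Σ| = q` (values `0, …, q-1`), and the list of constraints.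
[cite: Hirahara2022PartialMCSP, proof of Thm. 5.2 (p. 16)] -/
structure CSPInstance where
  /-- The number `n` of variables. -/
  numVars : ℕ
  /-- The alphabet size `|Σ|`. -/
  alphabetSize : ℕ
  /-- The constraints `C₁, …, C_m`. -/
  constraints : List CSPConstraint

namespace CSPInstance

/-- The number `m` of constraints. [cite: Hirahara2022PartialMCSP, proof of Thm. 5.2 (p. 16)] -/
def numConstraints (Ψ : CSPInstance) : ℕ :=
  Ψ.constraints.length

/-- The number of constraints satisfied by `a`, `#{j | Cⱼ(a) = 1}` (so that the fraction of
satisfied constraints is `satCount / m`). [cite: Hirahara2022PartialMCSP, proof of Thm. 5.2 (p. 17)] -/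
def satCount (Ψ : CSPInstance) (a : ℕ → ℕ) : ℕ :=
  Ψ.constraints.countP fun C => C.IsSatisfiedBy a

/-- Well-formed instances: every constraint is well formed over `n` variables and the alphabet
`[q]`, and there is at least one constraint. [cite: Hirahara2022PartialMCSP, proof of Thm. 5.2 (p. 16)] -/
def WellFormed (Ψ : CSPInstance) : Prop :=
  0 < Ψ.numConstraints ∧ ∀ C ∈ Ψ.constraints, C.WellFormed Ψ.numVars Ψ.alphabetSize

/-- `Ψ.HasArity D`: every constraint depends on exactly `D` variables (Thm. 5.2, proof: "Each
constraint `Cⱼ` depends on exactly `D = O(1/β)` variables"). [cite: Hirahara2022PartialMCSP, proof of Thm. 5.2 (p. 16)] -/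
def HasArity (Ψ : CSPInstance) (D : ℕ) : Prop :=
  ∀ C ∈ Ψ.constraints, C.vars.length = D

/-- `Ψ.IsSatisfiable`: some assignment satisfies every constraint. [cite: Hirahara2022PartialMCSP, proof of Thm. 5.2 (p. 17)] -/
def IsSatisfiable (Ψ : CSPInstance) : Prop :=
  ∃ a : ℕ → ℕ, ∀ C ∈ Ψ.constraints, C.IsSatisfiedBy a = true

/-- Well-formedness of an instance is decidable. [folklore] -/
instance decidableWellFormed (Ψ : CSPInstance) : Decidable Ψ.WellFormed := by
  unfold WellFormed
  infer_instance

/-- `HasArity` is decidable. [folklore] -/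
instance decidableHasArity (Ψ : CSPInstance) (D : ℕ) : Decidable (Ψ.HasArity D) := by
  unfold HasArity
  infer_instance

/-- `satCount` is at most the number of constraints. [folklore] -/
theorem satCount_le_numConstraints (Ψ : CSPInstance) (a : ℕ → ℕ) :
    Ψ.satCount a ≤ Ψ.numConstraints :=
  List.countP_le_length

/-- All constraints are satisfied by `a` iff `satCount a = m`. [folklore] -/
theorem satCount_eq_numConstraints_iff (Ψ : CSPInstance) (a : ℕ → ℕ) :
    Ψ.satCount a = Ψ.numConstraints ↔ ∀ C ∈ Ψ.constraints, C.IsSatisfiedBy a = true := by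
  simp [satCount, numConstraints, List.countP_eq_length]

/-! ### Boolean encoding of instances -/

/-- The instance as the tuple `(n, q, [(varsⱼ, acceptingⱼ)]ⱼ)`. [folklore] -/
def toTuple (Ψ : CSPInstance) : ℕ × ℕ × List (List ℕ × List (List ℕ)) :=
  (Ψ.numVars, Ψ.alphabetSize, Ψ.constraints.map fun C => (C.vars, C.accepting))

/-- The instance with tuple `(n, q, [(varsⱼ, acceptingⱼ)]ⱼ)`. [folklore] -/
def ofTuple (t : ℕ × ℕ × List (List ℕ × List (List ℕ))) : CSPInstance :=
  ⟨t.1, t.2.1, t.2.2.map fun c => ⟨c.1, c.2⟩⟩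

/-- `ofTuple` inverts `toTuple`. [folklore] -/
@[simp] theorem ofTuple_toTuple (Ψ : CSPInstance) : ofTuple Ψ.toTuple = Ψ := by
  obtain ⟨n, q, cs⟩ := Ψ
  simp only [toTuple, ofTuple, List.map_map, mk.injEq, true_and]
  conv_rhs => rw [← List.map_id cs]
  exact List.map_congr_left fun C _ => rfl

/-- `toTuple` inverts `ofTuple`. [folklore] -/
@[simp] theorem toTuple_ofTuple (t : ℕ × ℕ × List (List ℕ × List (List ℕ))) :
    (ofTuple t).toTuple = t := by
  obtain ⟨n, q, cs⟩ := t
  simp only [toTuple, ofTuple, List.map_map, Prod.mk.injEq, true_and]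
  conv_rhs => rw [← List.map_id cs]
  exact List.map_congr_left fun c _ => rfl

/-- The Boolean encoding of the tuple `(n, q, [(varsⱼ, acceptingⱼ)]ⱼ)` (numbers in binary,
lists as `listBool` codes). [folklore] -/
def tupleEncoding : Encoding (ℕ × ℕ × List (List ℕ × List (List ℕ))) Bool :=
  encodingNatBool.pairBool
    (encodingNatBool.pairBool
      (encodingNatBool.listBool.pairBool encodingNatBool.listBool.listBool).listBool)

/-- The Boolean encoding of MaxCSP instances (through `toTuple`/`ofTuple` and
`tupleEncoding`). [folklore] -/
def encoding : Encoding CSPInstance Bool where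
  encode Ψ := tupleEncoding.encode Ψ.toTuple
  decode v := (tupleEncoding.decode v).map ofTuple
  decode_encode Ψ := by simp [tupleEncoding.decode_encode]

/-- The encoding of an instance is the tuple code (definitional). [folklore] -/
theorem encoding_encode (Ψ : CSPInstance) :
    encoding.encode Ψ = tupleEncoding.encode Ψ.toTuple := rfl

end CSPInstance

/-! ### The gap problem -/

namespace GapCSP

/-- Yes-instances of the gap CSP with arity `D` and alphabet bound `Q`: well-formed instances of
arity exactly `D` with `|Σ| ≤ Q(n)` that are satisfiable (PCP: perfect completeness).
[cite: Hirahara2022PartialMCSP, Lemma 5.3 and proof of Thm. 5.2 (pp. 16–17)] -/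
def yesSet (D : ℕ) (Q : ℕ → ℝ) : Set CSPInstance :=
  {Ψ | Ψ.WellFormed ∧ Ψ.HasArity D ∧ (Ψ.alphabetSize : ℝ) ≤ Q Ψ.numVars ∧ Ψ.IsSatisfiable}

/-- No-instances of the gap CSP with arity `D`, alphabet bound `Q` and soundness `δ`:
well-formed instances of arity exactly `D` with `|Σ| ≤ Q(n)` in which every assignment
satisfies fewer than a `δ(n)`-fraction of the constraints, `#{j | Cⱼ(a) = 1} < δ(n) · m`
(PCP: soundness error below `δ`; strict form as `CMMSA.noSet`, see the module docstring).
[cite: Hirahara2022PartialMCSP, Lemma 5.3 and proof of Thm. 5.2 (pp. 16–17)] -/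
def noSet (D : ℕ) (Q δ : ℕ → ℝ) : Set CSPInstance :=
  {Ψ | Ψ.WellFormed ∧ Ψ.HasArity D ∧ (Ψ.alphabetSize : ℝ) ≤ Q Ψ.numVars ∧
    ∀ a : ℕ → ℕ, (Ψ.satCount a : ℝ) < δ Ψ.numVars * Ψ.numConstraints}

/-- The no-part grows with the soundness error: `δ ≤ δ'` pointwise gives
`noSet D Q δ ⊆ noSet D Q δ'`. [cite: Hirahara2022PartialMCSP, Lemma 5.3] -/
theorem noSet_mono {D : ℕ} {Q δ δ' : ℕ → ℝ} (h : ∀ n, δ n ≤ δ' n) :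
    noSet D Q δ ⊆ noSet D Q δ' := by
  rintro Ψ ⟨hwf, har, hq, hno⟩
  exact ⟨hwf, har, hq, fun a =>
    (hno a).trans_le (mul_le_mul_of_nonneg_right (h _) (Nat.cast_nonneg _))⟩

/-- For soundness `δ ≤ 1` the yes- and no-instances are disjoint: a satisfying assignment
satisfies all `m` constraints, never fewer than `δ · m ≤ m`. [cite: Hirahara2022PartialMCSP, Lemma 5.3] -/
theorem disjoint_yesSet_noSet {D : ℕ} {Q δ : ℕ → ℝ} (hδ : ∀ n, δ n ≤ 1) :
    Disjoint (yesSet D Q) (noSet D Q δ) := by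
  refine Set.disjoint_left.2 ?_
  rintro Ψ ⟨-, -, -, a, ha⟩ ⟨-, -, -, hno⟩
  have hsat : (Ψ.satCount a : ℝ) = Ψ.numConstraints := by
    exact_mod_cast (Ψ.satCount_eq_numConstraints_iff a).2 ha
  have h := hno a
  rw [hsat] at h
  have : δ Ψ.numVars * Ψ.numConstraints ≤ 1 * Ψ.numConstraints :=
    mul_le_mul_of_nonneg_right (hδ _) (Nat.cast_nonneg _)
  rw [one_mul] at this
  exact absurd (h.trans_le this) (lt_irrefl _)

end GapCSP

/-- The promise problem **gap CSP with arity `D`, alphabet bound `Q` and soundness `δ`** over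
`{0,1}` (the MaxCSP form of a PCP with perfect completeness, `D` queries, alphabet `Σ`,
`|Σ| ≤ Q(n)`, and soundness error `δ(n)`; Hirahara 2022, proof of Thm. 5.2): yes-instances are
the codes of `GapCSP.yesSet D Q`, no-instances the codes of `GapCSP.noSet D Q δ`, under
`CSPInstance.encoding`; the parameters are evaluated at `n = numVars`.
[cite: Hirahara2022PartialMCSP, Lemma 5.3 and proof of Thm. 5.2 (pp. 16–17)] -/
def gapCSP (D : ℕ) (Q δ : ℕ → ℝ) : PromiseProblem :=
  PromiseProblem.ofEncoding CSPInstance.encoding (GapCSP.yesSet D Q) (GapCSP.noSet D Q δ)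

/-- The yes-part of `gapCSP D Q δ` (definitional). [cite: Hirahara2022PartialMCSP, Lemma 5.3] -/
@[simp] theorem gapCSP_yes (D : ℕ) (Q δ : ℕ → ℝ) :
    (gapCSP D Q δ).yes = CSPInstance.encoding.toLanguage (GapCSP.yesSet D Q) := rfl

/-- The no-part of `gapCSP D Q δ` (definitional). [cite: Hirahara2022PartialMCSP, Lemma 5.3] -/
@[simp] theorem gapCSP_no (D : ℕ) (Q δ : ℕ → ℝ) :
    (gapCSP D Q δ).no = CSPInstance.encoding.toLanguage (GapCSP.noSet D Q δ) := rfl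

/-- For `δ ≤ 1`, `gapCSP D Q δ` is a genuine (disjoint) promise problem. [cite: Hirahara2022PartialMCSP, Lemma 5.3] -/
theorem gapCSP_disjoint {D : ℕ} {Q δ : ℕ → ℝ} (hδ : ∀ n, δ n ≤ 1) : (gapCSP D Q δ).Disjoint :=
  PromiseProblem.disjoint_ofEncoding _ (GapCSP.disjoint_yesSet_noSet hδ)

/-- The soundness functions `(log₂ n)^{-γ}`, `γ > 0`, never exceed `1` (`0^{-γ} = 0` for
`n < 2`, base `≥ 1` and exponent `≤ 0` otherwise). [folklore] -/
theorem rpow_neg_natLog_le_one (n : ℕ) {γ : ℝ} (hγ : 0 < γ) :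
    (Nat.log 2 n : ℝ) ^ (-γ) ≤ 1 := by
  rcases Nat.eq_zero_or_pos (Nat.log 2 n) with h | h
  · rw [h, Nat.cast_zero, Real.zero_rpow (neg_ne_zero.2 hγ.ne')]
    exact zero_le_one
  · exact Real.rpow_le_one_of_one_le_of_nonpos (by exact_mod_cast h) (neg_nonpos.2 hγ.le)

/-- At the parameters of Lemma 5.3 as vendored (`Hirahara2022_lem53_logPow_queried`,
`GapCSPQueried.lean`: soundness `(log₂ n)^{-γ}`) the gap CSP is disjoint for **every** size and
every `γ > 0` (so its NP-hardness is not witnessed by a constant map).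
[cite: Hirahara2022PartialMCSP, Lemma 5.3] -/
theorem gapCSP_logPow_disjoint (D : ℕ) (Q : ℕ → ℝ) {γ : ℝ} (hγ : 0 < γ) :
    (gapCSP D Q fun n => (Nat.log 2 n : ℝ) ^ (-γ)).Disjoint :=
  gapCSP_disjoint fun n => rpow_neg_natLog_le_one n hγ

/-- **Hardness is monotone in the soundness error**: a Karp reduction into `gapCSP D Q δ` is one
into `gapCSP D Q δ'` whenever `δ ≤ δ'` (same yes-part, larger no-part, `GapCSP.noSet_mono`).
[cite: Hirahara2022PartialMCSP, Lemma 5.3; Goldreich2006, Def. 1.4] -/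
theorem PromiseProblem.IsHard.gapCSP_mono {C : Set (Language Bool)} {D : ℕ} {Q δ δ' : ℕ → ℝ}
    (h : (gapCSP D Q δ).IsHard C) (hδ : ∀ n, δ n ≤ δ' n) : (gapCSP D Q δ').IsHard C := by
  intro L hL
  obtain ⟨f, hf, hy, hn⟩ := h L hL
  refine ⟨f, hf, hy, fun x hx => ?_⟩
  exact Encoding.toLanguage_mono _ (GapCSP.noSet_mono hδ) (hn hx)

end Literature.Computability.Complexity
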